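import Summits.BirchSwinnertonDyer.BirchSwinnertonDyer.Theorems.KolyvaginRoadThreeMethod2LocalEquivOfTame
import Literature.NumberTheory.GaloisRepresentations.DecompositionGroupOfCompletion
import Literature.NumberTheory.GaloisRepresentations.InertiaHomFrobeniusTwist
import Literature.NumberTheory.Automorphic.AdicCompletionResidueCard
import HarnessLib

/-!
# Route `KolyvaginRoadThree`, deciding crux `ZhangSharpFrameAtThreeHL` (item stmt-BirchSwinnertonDyer-19574):
# the TAME SIGN LAW (TS) at a unipotent-admissible prime — a Frobenius lift of complex conjugation, and its square,
# conjugate the inertia group trivially on the values of every cocycle with coefficients in `E[3]`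
# (cell `bsd-stepL`, seat `bsd-stepL-zhang3-p1` g7; `--supports stmt-BirchSwinnertonDyer-19574`, helper)

WHY THIS FILE. `KolyvaginRoadThreeMethod2LocalEquivOfTame` (zhang3-p1 g7) reduced the input (Equiv) of stub A of crux
19574 to the hypothesis (TS): at a place `v ∋ q` of a unipotent-admissible prime (`q ∤ 3N d_K`, `(q)` prime in `𝓞_K`,
`q ≡ 1 (mod 3)`), for an arithmetic Frobenius `h ∈ Γ_ℚ` at the prime of `\bar ℤ` below `𝔓 = 𝔓_{ι₀,𝔐}`, its
transport `t = e h e⁻¹` (a lift of `c`) and `F ∈ Γ_K` with `res F = h²`, every continuous cocycle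
`φ : Γ_K → E(K̄)[3]` has `φ(t⁻¹ i t) = φ(i) = φ(F i F⁻¹)` for `i ∈ I_𝔓`. This file PROVES (TS) for `[K : ℚ] = 2`,
from the tree's LOCAL tame theory: `φ|_{I_𝔓}` is a continuous homomorphism into the `3`-group `E[3]` (inertia acts
trivially: good reduction, `v ∤ 3`); transported along `I_𝔓 ≅ I_{𝔓'} = γ I_{𝔓₀} γ⁻¹ ≅ I_{ℚ_q}`
(`𝔓₀ = adicCompletionPrime ℚ (q)`: tree `inertia_adicCompletionPrime_eq_map_absInertia`,
`decompositionSubgroup_adicCompletionPrime_eq_range`, `isArithFrobAt_absGaloisRestrict_adicCompletionPrime_iff`,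
Neukirch II (9.6)) it becomes a continuous additive map `f : I_{ℚ_q} → E[3]`, for which the tree's
`InertiaHomFrobeniusTwist.apply_frob_conj_eq_card_nsmul` (Serre 1972 §1.8 Prop. 6: conjugation by a Frobenius acts on
tame inertia by `u ↦ u^q`) gives `f(σ₁ σ σ₁⁻¹) = q · f(σ) = f(σ)` (`q ≡ 1 (mod 3)`), `σ₁` a local Frobenius
restricting to `γ⁻¹ h γ`; `t⁻¹ · t` is `h⁻¹ · h` under `res`, and `F⁻¹ · F` is its square.
HONEST FRAMING: theorems only; no definition, no named fact, no `sorry`; (Cheb), (Iso), stub B untouched; nothing is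
booked. PARTITION: O2@3 (B10) × A1 × crux 19574 × stub A — none (kernel discharge of a typed local input; T7).

References: [cite: SerreInventiones1972, §1.8 Prop. 6] [cite: NeukirchANT1999, Ch. II §9 Prop. (9.6), Ch. I §9 (9.4)]
[cite: WZhang2014, §9 (9.2), Notations (xii)].
-/

noncomputable section

open scoped Pointwise Valued
open WeierstrassCurve NumberField IsDedekindDomain Field Rat.HeightOneSpectrum ValuativeRel
open Literature.NumberTheory.EllipticCurves Literature.NumberTheory.GaloisRepresentations Module
open Literature.NumberTheory.GaloisRepresentations.IsNonarchimedeanLocalField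

namespace Summit.BirchSwinnertonDyer.Rank1Residual.X11b.Three.Koly.Method2.LocalFrob

universe u

/-! ## §1 Bookkeeping: inertia under conjugation and under restriction -/

/-- Conjugation moves inertia groups along: `j ∈ I_𝔓 ⟹ γ j γ⁻¹ ∈ I_{γ𝔓}`. [folklore] -/
theorem conj_mem_inertia_smul {K : Type u} [Field K] {𝔓 : Ideal (absIntegers (𝓞 K) K)}
    {j : absoluteGaloisGroup K} (hj : j ∈ 𝔓.inertia (absoluteGaloisGroup K)) (γ : absoluteGaloisGroup K) :
    γ * j * γ⁻¹ ∈ (γ • 𝔓).inertia (absoluteGaloisGroup K) := by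
  intro x
  have h1 : γ • (j • γ⁻¹ • x - γ⁻¹ • x) ∈ γ • 𝔓 := Ideal.smul_mem_pointwise_smul γ _ 𝔓 (hj (γ⁻¹ • x))
  rw [smul_sub, smul_inv_smul] at h1
  rw [mul_smul, mul_smul]
  exact h1

variable (K : Type) [Field K] [NumberField K]

/-- **Restriction of the conjugation by the transported lift**: for `t = e h e⁻¹` (`h ∈ Γ_ℚ`) and `g ∈ Γ_K`,
`res (t⁻¹ g t) = h⁻¹ (res g) h` in `Γ_ℚ`. [folklore] -/
theorem absGaloisRestrict_conjGalCMH {c : K ≃ₐ[ℚ] K} {h : absoluteGaloisGroup ℚ}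
    (ht : IsLiftOfAut c (absGaloisTransport (K := ℚ) (L := K) h).toRingEquiv) (g : absoluteGaloisGroup K) :
    absGaloisRestrict ℚ K (ht.conjGalCMH g) = h⁻¹ * absGaloisRestrict ℚ K g * h := by
  refine FaithfulSMul.eq_of_smul_eq_smul (α := AlgebraicClosure ℚ) fun x ↦ ?_
  apply (Literature.NumberTheory.GaloisRepresentations.absClosureEmbedding_bijective ℚ K).1
  rw [absGaloisRestrict_apply_smul, mul_smul, mul_smul, ← absGaloisTransport_absClosureEmbedding h⁻¹, map_inv,
    absGaloisRestrict_apply_smul, ← absGaloisTransport_absClosureEmbedding h]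
  rfl

/-- **Inertia under restriction**: `g ∈ I_𝔓 ⟺ res g ∈ I_{𝔓'}` for `𝔓' = ι⁻¹ 𝔓` the prime of `\bar ℤ` below the
prime `𝔓` of `\bar ℤ_K` (`ι : \bar ℤ ≅ \bar ℤ_K`, tree `absIntegersMap`, equivariant and onto). [folklore] -/
theorem mem_inertia_iff_absGaloisRestrict_mem (𝔓 : Ideal (absIntegers (𝓞 K) K)) (g : absoluteGaloisGroup K) :
    g ∈ 𝔓.inertia (absoluteGaloisGroup K) ↔
      absGaloisRestrict ℚ K g ∈ (𝔓.comap (absIntegersMap ℚ K)).inertia (absoluteGaloisGroup ℚ) := by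
  constructor
  · intro hg x
    rw [Submodule.mem_toAddSubgroup, Ideal.mem_comap, map_sub, absIntegersMap_smul]
    exact hg _
  · intro hg y
    obtain ⟨x, rfl⟩ := absIntegersMap_surjective ℚ K y
    have h := hg x
    rw [Submodule.mem_toAddSubgroup, Ideal.mem_comap, map_sub, absIntegersMap_smul] at h
    exact h

omit [NumberField K] in
/-- `q • m = m` on `E[3]` when `q ≡ 1 (mod 3)`. [folklore] -/
theorem nsmul_eq_self_of_mod_three {W' : WeierstrassCurve K} {q : ℕ} (hq3 : q % 3 = 1)
    (m : geomTorsion W' ((3 ^ 1 : ℕ) : ℤ)) : q • m = m := by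
  have h3 : (3 : ℕ) • m = 0 := by
    have := (mem_geomTorsion_iff W' _ _).mp m.2
    apply Subtype.ext
    rw [AddSubgroupClass.coe_nsmul, ← natCast_zsmul]
    exact this
  obtain ⟨k, hk⟩ : ∃ k, q = k * 3 + 1 := ⟨q / 3, by omega⟩
  rw [hk, add_nsmul, one_nsmul, mul_nsmul', h3, nsmul_zero, zero_add]

omit [NumberField K] in
/-- A finite field with a prime number `q` of elements has characteristic `q`. [folklore] -/
theorem ringChar_eq_of_natCard_eq {k : Type*} [Field k] [Finite k] {q : ℕ} (hq : q.Prime)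
    (hk : Nat.card k = q) : ringChar k = q := by
  haveI := Fintype.ofFinite k
  have h0 := Nat.cast_card_eq_zero k
  rw [ringChar.spec, Fintype.card_eq_nat_card, hk] at h0
  exact ((Nat.dvd_prime hq).mp h0).resolve_left CharP.ringChar_ne_one

/-! ## §2 Serre's conjugation law at a prime of `\bar ℤ` above `q`, for maps on `Γ_K` -/

section Serre

/-- **Frobenius conjugation multiplies tame inertial values by `q`** — the number-field form at a prime `𝔓'` of
`\bar ℤ` above `q`, for a quadratic (Galois) `K` unramified at `q` and a continuous map `g : Γ_K → B` into a finite
discrete group of order prime to `q` which is additive on the elements restricting into `I_{𝔓'}`: if `res j = h (res i)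
h⁻¹` with `h` an arithmetic Frobenius at `𝔓'` and `res i ∈ I_{𝔓'}`, then `g j = q • g i`. Transfer of the tree's local
theorem `apply_frob_conj_eq_card_nsmul` (Serre 1972 §1.8 Prop. 6) along `I_{𝔓'} = γ I_{𝔓₀} γ⁻¹ = γ res(I_{ℚ_q}) γ⁻¹`
(`𝔓₀ = adicCompletionPrime ℚ (q)`; Neukirch II (9.6)) and `I_{𝔓'} ⊆ res Γ_K` (`q` unramified in `K`).
[cite: SerreInventiones1972, §1.8 Prop. 6] [cite: NeukirchANT1999, Ch. II §9 Prop. (9.6)] -/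
theorem apply_eq_nsmul_of_frob_conj [IsGalois ℚ K] {q : ℕ} (hqprime : q.Prime) {w : HeightOneSpectrum (𝓞 ℚ)}
    (hqw : (q : 𝓞 ℚ) ∈ w.asIdeal) (hunr : Algebra.IsUnramifiedIn (𝓞 K) w.asIdeal)
    {𝔓' : Ideal (absIntegers (𝓞 ℚ) ℚ)} (h𝔓' : 𝔓' ∈ w.primesAbove) {h : absoluteGaloisGroup ℚ}
    (hh : IsArithFrobAt (𝓞 ℚ) h 𝔓') {B : Type} [AddCommGroup B] [Finite B] [TopologicalSpace B] [DiscreteTopology B]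
    (hB : (Nat.card B).Coprime q) (g : absoluteGaloisGroup K → B) (hgc : Continuous g)
    (hgadd : ∀ a b : absoluteGaloisGroup K, absGaloisRestrict ℚ K a ∈ 𝔓'.inertia (absoluteGaloisGroup ℚ) →
      g (a * b) = g a + g b)
    {i j : absoluteGaloisGroup K} (hi : absGaloisRestrict ℚ K i ∈ 𝔓'.inertia (absoluteGaloisGroup ℚ))
    (hj : absGaloisRestrict ℚ K j = h * absGaloisRestrict ℚ K i * h⁻¹) : g j = q • g i := by
  haveI := h𝔓'.1
  -- the local field `ℚ_q`, the prime `𝔓₀` of its embedding, and `γ` with `γ 𝔓₀ = 𝔓'`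
  have h𝔓₀ : adicCompletionPrime ℚ w ∈ w.primesAbove := adicCompletionPrime_mem_primesAbove ℚ w
  haveI := h𝔓₀.1
  obtain ⟨γ, hγ⟩ := HeightOneSpectrum.exists_smul_eq_of_mem_primesAbove_holds h𝔓₀ h𝔓'
  have hIw := inertia_adicCompletionPrime_eq_map_absInertia ℚ w
  have hqcard : residueFieldCard (w.adicCompletion ℚ) = Nat.card (𝓞 ℚ ⧸ w.asIdeal) := by
    rw [Literature.NumberTheory.Automorphic.residueFieldCard_adicCompletion_eq, w.residueCard_eq_card_quotient]
  have hresq : w.residueCard = q := by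
    rw [HeightOneSpectrum.residueCard, ← span_natCast_rat_eq hqprime hqw, Ideal.absNorm_span_singleton,
      show (q : 𝓞 ℚ) = algebraMap ℤ (𝓞 ℚ) (q : ℤ) by simp, Algebra.norm_algebraMap,
      NumberField.RingOfIntegers.rank, Module.finrank_self, pow_one, Int.natAbs_natCast]
  -- `γ⁻¹ h γ` is a Frobenius at `𝔓₀`, the restriction of a local Frobenius `σ₁`
  have hh' : IsArithFrobAt (𝓞 ℚ) (γ⁻¹ * h * γ⁻¹⁻¹) (γ⁻¹ • 𝔓') := hh.conj γ⁻¹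
  have hγ' : γ⁻¹ • 𝔓' = adicCompletionPrime ℚ w := by rw [← hγ, inv_smul_smul]
  rw [inv_inv, hγ'] at hh'
  have hmemD : γ⁻¹ * h * γ ∈ (adicCompletionPrime ℚ w).decompositionSubgroup (absoluteGaloisGroup ℚ) :=
    hh'.mem_stabilizer
  rw [decompositionSubgroup_adicCompletionPrime_eq_range] at hmemD
  obtain ⟨σ₁, hσ₁⟩ := hmemD
  have hσ₁' : absGaloisRestrict ℚ (w.adicCompletion ℚ) σ₁ = γ⁻¹ * h * γ := hσ₁
  have hσ₁F : IsAbsArithFrob σ₁ :=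
    (isArithFrobAt_absGaloisRestrict_adicCompletionPrime_iff ℚ w hqcard σ₁).mp (by rw [hσ₁']; exact hh')
  -- the transfer `F' : I_{ℚ_q} → Γ_K`, `res (F' σ) = γ res(σ) γ⁻¹`
  have hinj := absGaloisRestrict_injective (K := ℚ) (L := K)
  have hIw' : ∀ σ : absInertia (w.adicCompletion ℚ),
      absGaloisRestrict ℚ (w.adicCompletion ℚ) σ ∈ (adicCompletionPrime ℚ w).inertia (absoluteGaloisGroup ℚ) :=
    fun σ ↦ by rw [hIw]; exact ⟨σ, σ.2, rfl⟩
  have hrange : ∀ σ : absInertia (w.adicCompletion ℚ),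
      γ * absGaloisRestrict ℚ (w.adicCompletion ℚ) σ * γ⁻¹ ∈ Set.range (absGaloisRestrict ℚ K) := fun σ ↦ by
    have h1 := conj_mem_inertia_smul (hIw' σ) γ
    rw [hγ] at h1
    exact inertia_le_range_absGaloisRestrict_of_isUnramifiedIn (K := K) hunr h𝔓' h1
  obtain ⟨F', hF'res, hF'cont⟩ : ∃ F' : absInertia (w.adicCompletion ℚ) → absoluteGaloisGroup K,
      (∀ σ, absGaloisRestrict ℚ K (F' σ) = γ * absGaloisRestrict ℚ (w.adicCompletion ℚ) σ * γ⁻¹) ∧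
      Continuous F' := by
    have he : Continuous (Equiv.ofInjective (absGaloisRestrict ℚ K) hinj) :=
      (map_continuous (absGaloisRestrict ℚ K)).subtype_mk _
    refine ⟨fun σ ↦ (Continuous.homeoOfEquivCompactToT2 he).symm
        ⟨γ * absGaloisRestrict ℚ (w.adicCompletion ℚ) σ * γ⁻¹, hrange σ⟩,
      fun σ ↦ Equiv.apply_ofInjective_symm hinj ⟨_, hrange σ⟩, ?_⟩
    exact (Continuous.homeoOfEquivCompactToT2 he).symm.continuous.comp
      (((continuous_const.mul ((map_continuous (absGaloisRestrict ℚ (w.adicCompletion ℚ))).comp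
        continuous_subtype_val)).mul continuous_const).subtype_mk _)
  have hF'I : ∀ σ, absGaloisRestrict ℚ K (F' σ) ∈ 𝔓'.inertia (absoluteGaloisGroup ℚ) := fun σ ↦ by
    rw [hF'res]
    have h1 := conj_mem_inertia_smul (hIw' σ) γ
    rwa [hγ] at h1
  have hF'mul : ∀ x y, F' (x * y) = F' x * F' y := fun x y ↦ hinj (by
    rw [map_mul, hF'res, hF'res, hF'res, Subgroup.coe_mul, map_mul]; group)
  -- Serre's law for `f = g ∘ F'`
  have hchar := ringChar_eq_of_natCard_eq hqprime
    ((Literature.NumberTheory.Automorphic.natCard_valuativeResidueField_adicCompletion_eq ℚ w).trans hresq)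
  have hB' := hB
  rw [← hchar] at hB'
  have hkey := apply_frob_conj_eq_card_nsmul (w.adicCompletion ℚ) (B := B) hB' (fun σ ↦ g (F' σ))
    (fun x y ↦ by simp only [hF'mul]; exact hgadd _ _ (hF'I x)) (hgc.comp hF'cont) hσ₁F
  rw [Literature.NumberTheory.Automorphic.residueFieldCard_adicCompletion_eq, hresq] at hkey
  -- `i = F' σ`, `j = F' (σ₁ σ σ₁⁻¹)`
  have h1 := conj_mem_inertia_smul hi γ⁻¹
  rw [inv_inv, hγ', hIw] at h1
  obtain ⟨σ, hσ, hσeq⟩ := h1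
  have hσeq' : absGaloisRestrict ℚ (w.adicCompletion ℚ) σ = γ⁻¹ * absGaloisRestrict ℚ K i * γ⁻¹⁻¹ := hσeq
  have hiF : F' ⟨σ, hσ⟩ = i := hinj (by
    rw [hF'res]
    change γ * absGaloisRestrict ℚ (w.adicCompletion ℚ) σ * γ⁻¹ = _
    rw [hσeq']; group)
  have hjF : F' ⟨σ₁ * σ * σ₁⁻¹, (inferInstance : (absInertia (w.adicCompletion ℚ)).Normal).conj_mem _ hσ σ₁⟩ = j :=
    hinj (by
      rw [hF'res, hj]
      change γ * absGaloisRestrict ℚ (w.adicCompletion ℚ) (σ₁ * σ * σ₁⁻¹) * γ⁻¹ = _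
      rw [map_mul, map_mul, map_inv, hσ₁', hσeq']; group)
  have h := hkey ⟨σ, hσ⟩
  simp only at h
  rw [hjF, hiF] at h
  exact h

end Serre

/-! ## §3 The tame sign law -/

section Main

variable (W : WeierstrassCurve ℚ) [W.IsElliptic] [W.IsGloballyMinimal]

/-- **The TAME SIGN LAW (TS) at the places above unipotent-admissible primes, for `[K : ℚ] = 2`** — the hypothesis of
`Method2.localEquiv_of_tameSign` DISCHARGED: for `v ∋ q` (`q` unipotent-admissible), `𝔓 = 𝔓_{ι₀,𝔐}`, an arithmetic
Frobenius `h ∈ Γ_ℚ` at `ι⁻¹𝔓`, `F ∈ Γ_K` with `res F = h²`, the transport `t` of `h` lifting `c`, and every continuous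
cocycle `φ : Γ_K → E(K̄)[3]`: `φ(t⁻¹ i t) = φ(i) = φ(F i F⁻¹)` for all `i ∈ I_𝔓` (`φ|_{I_𝔓}` is additive as `I_𝔓`
fixes `E[3]` — good reduction at `v ∤ 3`; `res (t⁻¹ i t) = h⁻¹ (res i) h`; §2 with `B = E[3]`, `#B = 9` prime to `q`,
and `q • m = m` on `E[3]`; twice for `F`, `t⁻¹ t⁻¹ g t t = F⁻¹ g F`).
[cite: SerreInventiones1972, §1.8 Prop. 6] [cite: NeukirchANT1999, Ch. II §9 Prop. (9.6)] -/
theorem tameSign_of_uAdmissible (hK2 : Module.finrank ℚ K = 2) (c : K ≃ₐ[ℚ] K) :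
    ∀ (v : HeightOneSpectrum (𝓞 K)) (𝔐 : Ideal (HeightOneSpectrum.localAbsIntegers v)),
      𝔐 ∈ v.localPrimesAbove → ∀ q : ℕ, IsUAdmissiblePrime W K q → (q : 𝓞 K) ∈ v.asIdeal →
      ∀ (h : absoluteGaloisGroup ℚ) (F : absoluteGaloisGroup K),
        IsArithFrobAt (𝓞 ℚ) h ((v.primeBelow (closureEmb (K := K) (v.adicCompletion K)) 𝔐).comap
          (absIntegersMap ℚ K)) → absGaloisRestrict ℚ K F = h ^ 2 →
      ∀ (ht : IsLiftOfAut c (absGaloisTransport (K := ℚ) (L := K) h).toRingEquiv)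
        (φ : contOneCocycles (discreteTopRep (absoluteGaloisGroup K) (geomTorsion (W.baseChange K) ((3 ^ 1 : ℕ) : ℤ)))),
      ∀ i ∈ (v.primeBelow (closureEmb (K := K) (v.adicCompletion K)) 𝔐).inertia (absoluteGaloisGroup K),
        φ.1 (ht.conjGalCMH i) = φ.1 i ∧ φ.1 (F * i * F⁻¹) = φ.1 i := by
  intro v 𝔐 h𝔐 q hq hqv h F hh hF ht φ
  haveI : Algebra.IsQuadraticExtension ℚ K := ⟨hK2⟩
  obtain ⟨hgood, h3v⟩ := hasGoodReductionAt_of_uAdmissible W K hq v hqv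
  obtain ⟨hqprime, -, -, hq3, hinert, hq13, -⟩ := hq
  set ι₀ := closureEmb (K := K) (v.adicCompletion K) with hι₀
  set 𝔓 := v.primeBelow ι₀ 𝔐 with h𝔓def
  have h𝔓 : 𝔓 ∈ v.primesAbove := HeightOneSpectrum.primeBelow_mem_primesAbove h𝔐
  haveI := h𝔓.1
  have hwv : v.asIdeal.under (𝓞 ℚ) = (v.under (𝓞 ℚ)).asIdeal := rfl
  have hqw : (q : 𝓞 ℚ) ∈ (v.under (𝓞 ℚ)).asIdeal := by
    rw [← hwv, Ideal.under_def, Ideal.mem_comap, map_natCast]; exact hqv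
  have h𝔓' : 𝔓.comap (absIntegersMap ℚ K) ∈ (v.under (𝓞 ℚ)).primesAbove :=
    comap_absIntegersMap_mem_primesAbove hwv h𝔓
  haveI := h𝔓'.1
  have hunr : Algebra.IsUnramifiedIn (𝓞 K) (v.under (𝓞 ℚ)).asIdeal :=
    isUnramifiedIn_of_span_natCast_isPrime hqprime hinert hqw
  have hI : 𝔓.inertia (absoluteGaloisGroup K) ≤ torsionFixing (W.baseChange K) ((3 ^ 1 : ℕ) : ℤ) :=
    inertia_le_torsionFixing (W.baseChange K) (fun h' ↦ h' hgood) h3v ι₀ h𝔐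
  -- `F` is in the decomposition group (`f(v|q) = 2` makes it a Frobenius at `𝔓`), `h` in that of `𝔓'`
  have hFD : F ∈ 𝔓.decompositionSubgroup (absoluteGaloisGroup K) :=
    (isArithFrobAt_of_absGaloisRestrict_eq_pow (F := ℚ) (M := K) hwv h𝔓 hh
      (by rw [hF, inertiaDeg_eq_two_of_isPrime_span K hK2 hqprime hinert v hqv])).mem_stabilizer
  have hhD : h ∈ (𝔓.comap (absIntegersMap ℚ K)).decompositionSubgroup (absoluteGaloisGroup ℚ) := hh.mem_stabilizer
  -- conjugation by `t` preserves `I_𝔓`; `t⁻¹ (t⁻¹ g t) t = F⁻¹ g F`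
  have hconjI : ∀ i ∈ 𝔓.inertia (absoluteGaloisGroup K), ht.conjGalCMH i ∈ 𝔓.inertia (absoluteGaloisGroup K) := by
    intro i hi
    rw [mem_inertia_iff_absGaloisRestrict_mem K, absGaloisRestrict_conjGalCMH K ht]
    have hstab : h⁻¹ • 𝔓.comap (absIntegersMap ℚ K) = 𝔓.comap (absIntegersMap ℚ K) :=
      Ideal.mem_decompositionSubgroup_iff.mp (Subgroup.inv_mem _ hhD)
    have := conj_mem_inertia_smul ((mem_inertia_iff_absGaloisRestrict_mem K 𝔓 i).mp hi) h⁻¹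
    rwa [inv_inv, hstab] at this
  have hconj2 : ∀ g : absoluteGaloisGroup K, ht.conjGalCMH (ht.conjGalCMH g) = F⁻¹ * g * F := fun g ↦ by
    apply absGaloisRestrict_injective (K := ℚ) (L := K)
    rw [absGaloisRestrict_conjGalCMH K ht, absGaloisRestrict_conjGalCMH K ht, map_mul, map_mul, map_inv, hF, pow_two]
    group
  -- §2 for `g = φ`, `B = E[3]`
  haveI : Finite (geomTorsion (W.baseChange K) ((3 ^ 1 : ℕ) : ℤ)) :=
    finite_torsionPoints_holds (W.baseChange K) (AlgebraicClosure K) (by norm_num)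
  have hB : (Nat.card (geomTorsion (W.baseChange K) ((3 ^ 1 : ℕ) : ℤ))).Coprime q := by
    have hc : Nat.card (geomTorsion (W.baseChange K) ((3 ^ 1 : ℕ) : ℤ)) = 3 ^ 2 :=
      card_torsionPoints_eq_sq_holds (W.baseChange K) (AlgebraicClosure K) (n := 3 ^ 1) (by norm_num)
    rw [hc]
    exact Nat.Coprime.pow_left _ ((Nat.coprime_primes Nat.prime_three hqprime).mpr (Ne.symm hq3))
  have hadd : ∀ a b : absoluteGaloisGroup K,
      absGaloisRestrict ℚ K a ∈ (𝔓.comap (absIntegersMap ℚ K)).inertia (absoluteGaloisGroup ℚ) →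
      φ.1 (a * b) = φ.1 a + φ.1 b := fun a b ha ↦ by
    rw [φ.2, discreteTopRep_ρ_apply, smul_eq_of_mem_torsionFixing (W.baseChange K) _
      (hI ((mem_inertia_iff_absGaloisRestrict_mem K 𝔓 a).mpr ha))]
  have hSerre : ∀ i j : absoluteGaloisGroup K, i ∈ 𝔓.inertia (absoluteGaloisGroup K) →
      absGaloisRestrict ℚ K j = h * absGaloisRestrict ℚ K i * h⁻¹ → φ.1 j = φ.1 i := by
    intro i j hi hj
    rw [apply_eq_nsmul_of_frob_conj K hqprime hqw hunr h𝔓' hh hB φ.1 φ.1.continuous hadd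
      ((mem_inertia_iff_absGaloisRestrict_mem K 𝔓 i).mp hi) hj]
    exact nsmul_eq_self_of_mod_three K hq13 _
  -- (TS).1 and (TS).2
  have hTS1 : ∀ i ∈ 𝔓.inertia (absoluteGaloisGroup K), φ.1 (ht.conjGalCMH i) = φ.1 i := by
    intro i hi
    refine (hSerre (ht.conjGalCMH i) i (hconjI i hi) ?_).symm
    rw [absGaloisRestrict_conjGalCMH K ht]; group
  intro i hi
  refine ⟨hTS1 i hi, ?_⟩
  have hi2 : F * i * F⁻¹ ∈ 𝔓.inertia (absoluteGaloisGroup K) := conj_mem_inertia K hFD hi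
  have h1 := hTS1 _ (hconjI _ hi2)
  rw [hTS1 _ hi2, hconj2] at h1
  rw [← h1]
  congr 1
  group

end Main

end LocalFrob

/-! ## §3 (Equiv) unconditionally; stub A from (Cheb) + (Iso) -/

section Assembly

variable (W : WeierstrassCurve ℚ) [W.IsElliptic] [W.IsGloballyMinimal] (K : Type) [Field K] [NumberField K]

/-- **(Equiv) of `selQ_rankLowering_on_of_localGlobal`, PROVED for `[K : ℚ] = 2` and `c ≠ 1`** (Zhang (9.2): complex
conjugation acts on `H¹(K_q, E[3])` by one scalar sign at every good unipotent-admissible `q`):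
`localEquiv_of_tameSign` + `tameSign_of_uAdmissible`. [cite: WZhang2014, §9 (9.2)] [cite: SerreInventiones1972, §1.8 Prop. 6] -/
theorem localEquiv_of_uAdmissible (hK2 : Module.finrank ℚ K = 2) {c : K ≃ₐ[ℚ] K} (hc1 : c ≠ 1) :
    ∀ q : {q // IsUAdmissiblePrime W K q}, FrobSqNeOneAt W 3 q.1 → ∃ s : Bool,
      ∀ v : HeightOneSpectrum (𝓞 K), ((q : ℕ) : 𝓞 K) ∈ v.asIdeal → ∀ z : V3 W K,
        (W.baseChange K).torsionLocMap (v.adicCompletion K) ((3 ^ 1 : ℕ) : ℤ) (conjAct W c ((3 ^ 1 : ℕ) : ℤ) z) =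
          sgn s • (W.baseChange K).torsionLocMap (v.adicCompletion K) ((3 ^ 1 : ℕ) : ℤ) z :=
  localEquiv_of_tameSign W K hK2 hc1 (LocalFrob.tameSign_of_uAdmissible K W hK2 c)

end Assembly

end Summit.BirchSwinnertonDyer.Rank1Residual.X11b.Three.Koly.Method2

end
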